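import Summits.QuantumFields.BalabanUV.Beta.EriceFlowEnclosureB12AsPrintedTuned

/-!
# Beta / EriceFlowEnclosureB12AsPrintedLower — the LOWER ∕ POSITIVITY side of the β-flow enclosure, read LITERALLY AGAINST THE
# AS-PRINTED INTERFACE OF [I]: `Balaban1983to89.B12BetaAsPrinted` (β-flow team, prover 2 = lower ∕ positivity side, unit
# `b2b-balaban-beta-bflow-p2`, gen 40; ROW AP-I, lower half — the [I]-side twin of gen 11's `EriceFlowEnclosureAsPrintedLower` over the Erice
# interface `BalabanJaffe1986.BetaFlowAsPrinted`; companions on the same carrier: prover 1's `…B12AsPrintedUpper` (print alone ⟹ the UPPER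
# half of (0.31); the letters ⟹ Theorem 2), `…B12AsPrintedTuned` (the tuned runs are runs Theorem 3 speaks of), an4's `B12AsPrintedRowD4Junction`)

HONEST FRAMING (page 1 of everything the β sub-cell writes): discharging `BetaPertH` makes Bałaban's UV stability UNCONDITIONAL — a
real constructive-QFT result; it is NOT the continuum limit and NOT the Clay problem.  HONEST DEPENDENCY (cell reorg 2026-08-19,
verbatim): «continuum YM on T⁴ ⇐ BetaPertH ∧ nine spine estimates (0/9 proved); BetaPertH ⇐ (D1) ∧ (D4) ∧ CAP+tail; G-an2-4 gates
asym, D1 and NE2/3/4.»  THIS MODULE DISCHARGES NOTHING: it is bookkeeping from the NAMED FIELDS of the statement-exact typing of [I] =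
T. Bałaban, *Renormalization group approach to lattice gauge field theories. I*, Commun. Math. Phys. **109** (1987) 249–301
[Balaban1987RG1] — `B12BetaAsPrinted` (typer unit `b2b-balaban-beta-asprinted`, p537882 ✓ ∕ v1.1 p539116 ✓; `Setting S` = the printed
objects; `StandingHypotheses S` ∕ `Definitions S` ∕ `Conclusions S` = p. 251 + Theorem 3's hypotheses ∕ the printed definitions (0.18)–(0.20),
(1.3)∕(1.6), (1.20)–(1.22), (2.13)–(2.15) ∕ Theorem 3's conclusions with (5.10), (5.37)–(5.44); `RunHyp S P` = Theorem 3's run hypothesis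
«defined inductively by (0.17)–(0.20)», «0 < g_k ≦ γ, k = 0, …, K»; `Theorem2Statement S hL` = Theorem 2 ∕ (0.31) BY NAME — STATED
WITHOUT PROOF in print (p. 259; [Balaban1989LargeFieldII] p. 355 «has not been published yet»), a HYPOTHESIS here).  Every field enters as a
HYPOTHESIS on an abstract `Setting S`; nothing of [I] is asserted; no field is claimed for Bałaban's objects.

THE LOWER SIDE.  Of Theorem 2's display (0.31) `1∕g² + β log(L^kε)⁻¹ ≦ 1∕g_k² ≦ 1∕g² + β′ log(L^kε)⁻¹` the RIGHT inequality follows from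
what [I]+[II] prove (prover 1, `…B12AsPrintedUpper` §1); the LEFT inequality, with **β > 0**, is the part not in print — ASYMPTOTIC
FREEDOM.  This file records, on the as-printed carrier and by name: (§1) what that left inequality FORCES about [I]'s β-functions along
the runs — positivity of every SUFFIX AVERAGE and, with print's uniform bound |β_{j+1}| ≦ β′₅₁₀ (Theorem 3 + (5.10) + (5.42)), positivity
`≥ β ln L ∕ 2` on a set of steps of DENSITY ≥ (β ln L)∕(2β′₅₁₀ − β ln L) in every final window (never pointwise positivity:
`FlowStep.suffix_lower_not_pointwise`); (§2) what it HANDS DOWNSTREAM — the asymptotic-freedom envelope `g_k² ≦ 1∕(1∕g² + β ln L·(K − k))`,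
`g_k ≦ g`, the summability `Σ_{k<K} g_k⁶ ≦ g⁴∕(2β ln L)` behind [Balaban1988Convergent] (2.46), and the two-sided law for the BARE coupling
`1∕(1∕g² + β′ log ε⁻¹) ≦ g₀(ε, g)² ≦ 1∕(1∕g² + β log ε⁻¹)`, ε = L^{−K} — the shape of [Balaban1989LargeFieldI] p. 175: *"For d = 4 the bare
coupling constant behaves asymptotically as (a + b log ε⁻¹)^{−1∕2}, for ε → 0, with some positive constants a, b"* — so g₀(ε, g) → 0 at the
universal rate (β log ε⁻¹)^{−1∕2}, uniformly in the renormalized coupling.  The companion `…B12AsPrintedLowerEnd` shows that the interval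
clause «contained in ]0, γ]» of Theorem 2 is CARRIED by (0.31) (a γ-free equivalent form) and that the FIRST SENTENCE of Theorem 2 follows
on this carrier from partial-sum positivity alone.

WHAT THIS FILE PROVES (0 sorry, 0 def; [folklore] algebra + bookkeeping by name):
§0 raw lower-half algebra of `Step.Discrete031` (`sq_le_inv_of_le_inv_sq`, `inv_le_sq_of_inv_sq_le`, `sq_le_of_discrete031_lower`,
   `le_final_of_discrete031_lower`, `sq_le_envelope_of_discrete031_lower`, `bare_sq_twoSided_of_discrete031`, `sum_pow_six_le_of_discrete031_lower`)
   and the density count `card_filter_ge_of_sum_ge` (x_j ≤ B on s, Σ_s x ≥ b·|s| ⟹ (b − c)|s| ≤ (B − c)·#{j ∈ s : c ≤ x_j}).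
§1 NECESSITY on the carrier: `suffix_bounds_of_discrete031` ((0.31) per step ⟺-half: suffix sums of β_{j+1}(g₀, …, g_j) between b(K − k) and
   β′(K − k), `FlowStep.inv_sq_telescopeH`), **`af_steps_density`** (+ `Definitions ∧ Conclusions ∧ RunHyp`: `(b∕2)(K − k) ≤ (β′₅₁₀ − b∕2)·#{j ∈
   [k, K) : b∕2 ≤ β_{j+1}(g₀, …, g_j)}`), HEADLINE **`theorem2Statement_forces_af_steps`** (`Theorem2Statement S hL` + prover 1's located binder
   `hrg` «inside the interval the couplings obey (0.20)» + `Definitions ∧ Conclusions` ⟹ along every tuned run, for every k ≤ K: the suffix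
   sum from k is ≥ β ln L·(K − k) AND the density statement with b = β ln L ≤ β′₅₁₀).
§2 CONSEQUENCES on the carrier: HEADLINE **`bareCoupling_law_of_theorem2Statement`** (`Definitions S` + `Theorem2Statement S hL` ⟹ for every m,
   small γ, small g, 0 < β ≤ β′, every K, a bare coupling g₀ with: run in ]0, γ], g_K = g, `1∕(1∕g² + β′ ln L·K) ≤ g₀² ≤ 1∕(1∕g² + β ln L·K)`,
   `g_k ≤ g` and `g_k² ≤ 1∕(1∕g² + β ln L·(K − k))` for k ≤ K, `Σ_{k<K} g_k⁶ ≤ g⁴∕(2β ln L)`), **`bareCoupling_rate_of_theorem2Statement`**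
   (`g₀² · (β·log ε⁻¹) ≤ 1`, ε = L^{−K}, K ≥ 1, uniformly in g: the bare coupling VANISHES in the continuum limit at the rate of
   [Balaban1989LargeFieldI] p. 175).
NOT CLAIMED: that any field of `B12BetaAsPrinted` holds for Bałaban's objects; `hrg`; pointwise positivity of β; Theorem 2; `BetaPertH`;
continuum; Clay.
-/

namespace Summit.QuantumFields.BalabanUV.Beta.EriceFlowEnclosureB12AsPrintedLower

open Literature.MathematicalPhysics.QuantumFieldTheory.Balaban1983to89
open Literature.MathematicalPhysics.QuantumFieldTheory.Balaban1983to89.B12BetaAsPrinted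
open Literature.MathematicalPhysics.QuantumFieldTheory.Balaban1983to89.B12Sec2to5 (betaPrime510)
open Literature.MathematicalPhysics.QuantumFieldTheory.Balaban1983to89.FlowStep (prefixOf)
open Summit.QuantumFields.BalabanUV.Beta.B12AsPrintedRowD4Junction (abs_beta_prefix_le_betaPrime510)
open Summit.QuantumFields.BalabanUV.Beta.EriceFlowEnclosureB12AsPrintedUpper
open Summit.QuantumFields.BalabanUV.Beta.EriceFlowEnclosureB12AsPrintedTuned

noncomputable section

variable {S : Setting}

/-! ## §0 Raw algebra of the lower half of the discrete (0.31), and a density count -/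

/-- `c ≤ 1∕x²` with `x, c > 0` gives `x² ≤ 1∕c`. [folklore] -/
theorem sq_le_inv_of_le_inv_sq {x c : ℝ} (hx : 0 < x) (hc : 0 < c) (h : c ≤ 1 / x ^ 2) : x ^ 2 ≤ 1 / c := by
  rw [le_div_iff₀ hc]
  have hx2 : 0 < x ^ 2 := pow_pos hx 2
  have e : x ^ 2 * (1 / x ^ 2) = 1 := by field_simp
  nlinarith [mul_le_mul_of_nonneg_left h hx2.le]

/-- `1∕x² ≤ c` with `x, c > 0` gives `1∕c ≤ x²`. [folklore] -/
theorem inv_le_sq_of_inv_sq_le {x c : ℝ} (hx : 0 < x) (hc : 0 < c) (h : 1 / x ^ 2 ≤ c) : 1 / c ≤ x ^ 2 := by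
  rw [div_le_iff₀ hc]
  have hx2 : 0 < x ^ 2 := pow_pos hx 2
  have e : x ^ 2 * (1 / x ^ 2) = 1 := by field_simp
  nlinarith [mul_le_mul_of_nonneg_left h hx2.le]

/-- **The asymptotic-freedom envelope from the lower half.**  `Step.Discrete031 b β′ K g gs` with `b ≥ 0`, `g > 0`: at every `k ≤ K` with
`gs k > 0`, `(gs k)² ≤ 1∕(1∕g² + b(K − k))` — the effective coupling at scale k is bounded by a function of the NUMBER OF REMAINING STEPS.
[cite: Balaban1987RG1, Thm 2 (0.31) p.259 (left inequality)] -/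
theorem sq_le_of_discrete031_lower {b β' g : ℝ} {K : ℕ} {gs : ℕ → ℝ} (hD : Step.Discrete031 b β' K g gs) (hb : 0 ≤ b)
    (hg : 0 < g) {k : ℕ} (hk : k ≤ K) (hpos : 0 < gs k) :
    (gs k) ^ 2 ≤ 1 / (1 / g ^ 2 + b * ((K : ℝ) - k)) := by
  have hKk : (0 : ℝ) ≤ (K : ℝ) - k := by
    have : (k : ℝ) ≤ K := by exact_mod_cast hk
    linarith
  have hc : 0 < 1 / g ^ 2 + b * ((K : ℝ) - k) := by positivity
  exact sq_le_inv_of_le_inv_sq hpos hc (hD k hk).1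

/-- **Every effective coupling is below the renormalized one**: the lower half with `b ≥ 0` gives `gs k ≤ g` (k ≤ K, gs k > 0) — so a run that
ends at a small g IS small throughout; this is why (0.31) carries Theorem 2's interval clause ([Balaban1989LargeFieldII] p. 355: *"this
assumption follows from the basic inequality (0.31)"*; `Step.inInterval_of_discrete031`). [cite: Balaban1989LargeFieldII, Thm 1 p.355; Balaban1987RG1, Thm 2 (0.31) p.259] -/
theorem le_final_of_discrete031_lower {b β' g : ℝ} {K : ℕ} {gs : ℕ → ℝ} (hD : Step.Discrete031 b β' K g gs) (hb : 0 ≤ b)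
    (hg : 0 < g) {k : ℕ} (hk : k ≤ K) (hpos : 0 < gs k) : gs k ≤ g := by
  have hKk : (0 : ℝ) ≤ (K : ℝ) - k := by
    have : (k : ℝ) ≤ K := by exact_mod_cast hk
    linarith
  have h1 : 1 / g ^ 2 ≤ 1 / (gs k) ^ 2 := by
    have := (hD k hk).1
    nlinarith [mul_nonneg hb hKk]
  have h2 : (gs k) ^ 2 ≤ g ^ 2 := by rwa [one_div_le_one_div (pow_pos hg 2) (pow_pos hpos 2)] at h1
  exact (pow_le_pow_iff_left₀ hpos.le hg.le (by norm_num : (2 : ℕ) ≠ 0)).1 h2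

/-- **The envelope does not see the renormalized coupling**: with `b > 0` and `k < K`, `(gs k)² ≤ 1∕(b(K − k))` whatever g is.
[cite: Balaban1987RG1, Thm 2 (0.31) p.259 (left inequality)] -/
theorem sq_le_envelope_of_discrete031_lower {b β' g : ℝ} {K : ℕ} {gs : ℕ → ℝ} (hD : Step.Discrete031 b β' K g gs) (hb : 0 < b)
    (hg : 0 < g) {k : ℕ} (hk : k < K) (hpos : 0 < gs k) :
    (gs k) ^ 2 ≤ 1 / (b * ((K : ℝ) - k)) := by
  have hKk : (0 : ℝ) < (K : ℝ) - k := by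
    have : (k : ℝ) + 1 ≤ K := by exact_mod_cast hk
    linarith
  have h1 := sq_le_of_discrete031_lower hD hb.le hg hk.le hpos
  have hc : 0 < b * ((K : ℝ) - k) := mul_pos hb hKk
  exact h1.trans (one_div_le_one_div_of_le hc (by linarith [one_div_pos.mpr (pow_pos hg 2)]))

/-- **The bare coupling pinned two-sidedly**: the full discrete (0.31) at `k = 0` gives `1∕(1∕g² + β′K) ≤ (gs 0)² ≤ 1∕(1∕g² + bK)` (0 ≤ b ≤ β′,
g > 0, gs 0 > 0) — with ε = L^{−K}, K ln L = log ε⁻¹, this is `(1∕g² + β′ log ε⁻¹)^{−1} ≤ g₀² ≤ (1∕g² + β log ε⁻¹)^{−1}`, the shape of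
[Balaban1989LargeFieldI] p. 175 *"(a + b log ε⁻¹)^{−1∕2} … with some positive constants a, b"* (a = 1∕g²). [cite: Balaban1989LargeFieldI, p.175; Balaban1987RG1, Thm 2 (0.31) p.259] -/
theorem bare_sq_twoSided_of_discrete031 {b β' g : ℝ} {K : ℕ} {gs : ℕ → ℝ} (hD : Step.Discrete031 b β' K g gs) (hb : 0 ≤ b)
    (hbb' : b ≤ β') (hg : 0 < g) (hpos : 0 < gs 0) :
    1 / (1 / g ^ 2 + β' * K) ≤ (gs 0) ^ 2 ∧ (gs 0) ^ 2 ≤ 1 / (1 / g ^ 2 + b * K) := by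
  have h0 := hD 0 (Nat.zero_le K)
  simp only [Nat.cast_zero, sub_zero] at h0
  have hβ' : 0 ≤ β' := hb.trans hbb'
  have hc' : 0 < 1 / g ^ 2 + β' * K := by positivity
  have hc : 0 < 1 / g ^ 2 + b * K := by positivity
  exact ⟨inv_le_sq_of_inv_sq_le hpos hc' h0.2, sq_le_inv_of_le_inv_sq hpos hc h0.1⟩

/-- **Summability from the lower half** (the estimate behind the middle inequality of [Balaban1988Convergent] (2.46), `Step.sum_sixth_powers_le`
by name): the lower half with `b > 0` along a positive run ending at g gives `Σ_{k<K} (gs k)⁶ ≤ g⁴∕(2b)`, uniformly in K.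
[cite: Balaban1988Convergent, (2.46) p.263; Balaban1987RG1, Thm 2 (0.31) p.259] -/
theorem sum_pow_six_le_of_discrete031_lower {b β' g : ℝ} {K : ℕ} {gs : ℕ → ℝ} (hD : Step.Discrete031 b β' K g gs) (hb : 0 < b)
    (hg : 0 < g) (hpos : ∀ k, k ≤ K → 0 < gs k) :
    ∑ k ∈ Finset.range K, (gs k) ^ 6 ≤ g ^ 4 / (2 * b) := by
  have hy : 0 < 1 / g ^ 2 := by positivity
  have h := Step.sum_sixth_powers_le (n := K) (g := gs) hy hb (fun j hj => hpos j hj.le) fun j hj => (hD j hj.le).1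
  have e : 1 / (2 * b * (1 / g ^ 2) ^ 2) = g ^ 4 / (2 * b) := by
    field_simp
  rwa [e] at h

/-- **Density count.**  If `x_j ≤ B` on a finite set `s` and `Σ_{j∈s} x_j ≥ b·|s|`, then for every threshold `c` the elements with `x_j ≥ c`
number at least `(b − c)∕(B − c)·|s|`, in the division-free form `(b − c)·|s| ≤ (B − c)·#{j ∈ s : c ≤ x_j}` (the others contribute < c each).
[folklore] -/
theorem card_filter_ge_of_sum_ge {ι : Type*} (s : Finset ι) (x : ι → ℝ) {b B : ℝ} (c : ℝ) (hB : ∀ j ∈ s, x j ≤ B)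
    (hsum : b * s.card ≤ ∑ j ∈ s, x j) :
    (b - c) * s.card ≤ (B - c) * (s.filter (fun j => c ≤ x j)).card := by
  classical
  set t : Finset ι := s.filter (fun j => c ≤ x j) with ht
  set r : Finset ι := s.filter (fun j => ¬ c ≤ x j) with hr
  have hsplit : ∑ j ∈ t, x j + ∑ j ∈ r, x j = ∑ j ∈ s, x j := Finset.sum_filter_add_sum_filter_not s _ x
  have h1 : ∑ j ∈ t, x j ≤ B * t.card := by
    calc ∑ j ∈ t, x j ≤ ∑ _j ∈ t, B := Finset.sum_le_sum fun j hj => hB j (Finset.mem_of_mem_filter j hj)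
      _ = B * t.card := by rw [Finset.sum_const, nsmul_eq_mul, mul_comm]
  have h2 : ∑ j ∈ r, x j ≤ c * r.card := by
    calc ∑ j ∈ r, x j ≤ ∑ _j ∈ r, c := Finset.sum_le_sum fun j hj => (not_le.mp (Finset.mem_filter.mp hj).2).le
      _ = c * r.card := by rw [Finset.sum_const, nsmul_eq_mul, mul_comm]
  have hcard : (t.card : ℝ) + r.card = s.card := by
    exact_mod_cast Finset.card_filter_add_card_filter_not (s := s) (fun j => c ≤ x j)
  have e1 : (b - c) * (s.card : ℝ) = b * s.card - c * s.card := by ring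
  have e2 : (B - c) * (t.card : ℝ) = B * t.card - c * t.card := by ring
  have e3 : c * (s.card : ℝ) = c * t.card + c * r.card := by rw [← hcard]; ring
  linarith

/-! ## §1 NECESSITY on the as-printed carrier: what the lower half of (0.31) forces about [I]'s β-functions along the runs -/

/-- **(0.31) per step ⟹ two-sided bounds on every SUFFIX SUM of the β's along the run.**  For a run obeying the history recursion (0.20)
(`FlowStep.RGEqH`, β read at the run's own histories — `RunHyp.rg`) and the discrete (0.31) with constants b, β′:
`b(K − k) ≤ Σ_{j∈[k,K)} β_{j+1}(g₀, …, g_j) ≤ β′(K − k)` for every k ≤ K (telescoped (0.20), `FlowStep.inv_sq_telescopeH`; the lower half is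
EQUIVALENT to the lower suffix bounds, `FlowStep.discrete031_lower_iff_suffix`, and does NOT force a pointwise bound,
`FlowStep.suffix_lower_not_pointwise`). [cite: Balaban1987RG1, Thm 2 (0.31) p.259 with (0.20) p.256 and p.298] -/
theorem suffix_bounds_of_discrete031 {P : B12.RunParams} (hrg : FlowStep.RGEqH P.K S.β (S.cpl P)) {b β' : ℝ}
    (h : Step.Discrete031 b β' P.K (S.cpl P P.K) (S.cpl P)) {k : ℕ} (hk : k ≤ P.K) :
    b * ((P.K : ℝ) - k) ≤ ∑ j ∈ Finset.Ico k P.K, S.β j (prefixOf (S.cpl P) j) ∧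
      ∑ j ∈ Finset.Ico k P.K, S.β j (prefixOf (S.cpl P) j) ≤ β' * ((P.K : ℝ) - k) := by
  have ht := FlowStep.inv_sq_telescopeH hrg hk le_rfl
  have hk' := h k hk
  constructor <;> linarith [hk'.1, hk'.2]

/-- **AF ON A POSITIVE-DENSITY SET OF STEPS.**  Along a run Theorem 3 speaks of (`RunHyp S P`), with the printed `Definitions ∧ Conclusions`
(whence |β_{j+1}(g₀, …, g_j)| ≤ β′₅₁₀ := betaPrime510 4 (C510·E₀) δ₁ at every step, an4's `abs_beta_prefix_le_betaPrime510`) and the discrete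
(0.31) with lower constant b: in every final window [k, K) the steps j with `β_{j+1}(g₀, …, g_j) ≥ b∕2` number at least
`(b∕2)(K − k)∕(β′₅₁₀ − b∕2)`: `(b∕2)·(K − k) ≤ (β′₅₁₀ − b∕2)·#{j ∈ [k, K) : b∕2 ≤ β_{j+1}(g₀, …, g_j)}`.  The honest necessary form of
asymptotic freedom that Theorem 2 AS PRINTED encodes for [I]'s β along its runs. [cite: Balaban1987RG1, Thm 2 (0.31) p.259 with Thm 3 p.264, (5.10) p.293, (5.42) p.297] -/
theorem af_steps_density (hD : Definitions S) (hC : Conclusions S) {P : B12.RunParams} (hP : RunHyp S P) {b β' : ℝ}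
    (h : Step.Discrete031 b β' P.K (S.cpl P P.K) (S.cpl P)) {k : ℕ} (hk : k ≤ P.K) :
    b / 2 * ((P.K : ℝ) - k) ≤ (betaPrime510 4 (S.C510 * S.E₀) S.δ₁ - b / 2) *
      ((Finset.Ico k P.K).filter (fun j => b / 2 ≤ S.β j (prefixOf (S.cpl P) j))).card := by
  have hlo := (suffix_bounds_of_discrete031 hP.rg h hk).1
  have hcard : ((Finset.Ico k P.K).card : ℝ) = (P.K : ℝ) - k := by rw [Nat.card_Ico, Nat.cast_sub hk]
  rw [← hcard] at hlo
  have hB : ∀ j ∈ Finset.Ico k P.K, S.β j (prefixOf (S.cpl P) j) ≤ betaPrime510 4 (S.C510 * S.E₀) S.δ₁ := fun j hj =>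
    (abs_le.mp (abs_beta_prefix_le_betaPrime510 hD hC hP (Nat.succ_le_of_lt (Finset.mem_Ico.mp hj).2))).2
  have hd := card_filter_ge_of_sum_ge (Finset.Ico k P.K) (fun j => S.β j (prefixOf (S.cpl P) j)) (b / 2) hB hlo
  rw [hcard] at hd
  have e : b - b / 2 = b / 2 := by ring
  rwa [e] at hd

/-- **WHAT [I] THEOREM 2 AS PRINTED FORCES ABOUT [I]'s β ALONG ITS RUNS.**  `Theorem2Statement S hL`, prover 1's located binder `hrg` («inside the
interval ]0, γ] the construction's couplings obey (0.20)» — print DEFINES g_{k+1} by (0.20), p. 256; the interface types its forward-determination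
half `d020` only) and the printed `Definitions ∧ Conclusions` give: for every m, every γ ≤ min(γ₀, S.γ), every small g there is β > 0 with
`β ln L ≤ β′₅₁₀` (prover 1's `theorem2_rate_le_betaPrime510`) such that at EVERY K some bare coupling g₀ yields a run Theorem 3 speaks of, ending at
g, along which for every k ≤ K: **`Σ_{j∈[k,K)} β_{j+1}(g₀, …, g_j) ≥ β ln L·(K − k)`** (every suffix average of β is ≥ β ln L > 0) AND **`(β ln L∕2)(K − k)
≤ (β′₅₁₀ − β ln L∕2)·#{j ∈ [k, K) : β ln L∕2 ≤ β_{j+1}(g₀, …, g_j)}`** (β ≥ β ln L∕2 on a set of steps of density ≥ β ln L∕(2β′₅₁₀ − β ln L) in every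
final window).  Pointwise positivity is NOT forced (`FlowStep.suffix_lower_not_pointwise`). [cite: Balaban1987RG1, Thm 2 (0.31) p.259 with Thm 3 p.264 and (0.20) p.256] -/
theorem theorem2Statement_forces_af_steps {hL : Odd S.L ∧ 1 < S.L} (h : Theorem2Statement S hL)
    (hrg : ∀ P : B12.RunParams, Step.InInterval S.γ P.K (S.cpl P) → FlowStep.RGEqH P.K S.β (S.cpl P))
    (hD : Definitions S) (hC : Conclusions S) (m : ℕ) :
    ∃ γ₀ : ℝ, 0 < γ₀ ∧ ∀ γ : ℝ, 0 < γ → γ ≤ γ₀ → γ ≤ S.γ → ∃ g₁ : ℝ, 0 < g₁ ∧ ∀ g : ℝ, 0 < g → g ≤ g₁ →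
      ∃ β : ℝ, 0 < β ∧ β * Real.log S.L ≤ betaPrime510 4 (S.C510 * S.E₀) S.δ₁ ∧ ∀ K : ℕ, ∃ g₀ : ℝ,
        RunHyp S ⟨K, m, g₀⟩ ∧ S.cpl ⟨K, m, g₀⟩ K = g ∧ ∀ k, k ≤ K →
          β * Real.log S.L * ((K : ℝ) - k) ≤ ∑ j ∈ Finset.Ico k K, S.β j (prefixOf (S.cpl ⟨K, m, g₀⟩) j) ∧
          β * Real.log S.L / 2 * ((K : ℝ) - k) ≤ (betaPrime510 4 (S.C510 * S.E₀) S.δ₁ - β * Real.log S.L / 2) *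
            ((Finset.Ico k K).filter (fun j => β * Real.log S.L / 2 ≤ S.β j (prefixOf (S.cpl ⟨K, m, g₀⟩) j))).card := by
  obtain ⟨γ₀, hγ₀, hγ⟩ := theorem2_rate_le_betaPrime510 h hrg hD hC m
  refine ⟨γ₀, hγ₀, fun γ hγpos hγle hγS => ?_⟩
  obtain ⟨g₁, hg₁, hg⟩ := hγ γ hγpos hγle hγS
  refine ⟨g₁, hg₁, fun g hgpos hgle => ?_⟩
  obtain ⟨β, β', hβ, -, hrate, hK⟩ := hg g hgpos hgle
  refine ⟨β, hβ, hrate, fun K => ?_⟩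
  obtain ⟨g₀, hR, hend, h031⟩ := hK K
  refine ⟨g₀, hR, hend, fun k hk => ?_⟩
  have h031' : Step.Discrete031 (β * Real.log S.L) (min (β' * Real.log S.L) (betaPrime510 4 (S.C510 * S.E₀) S.δ₁))
      (⟨K, m, g₀⟩ : B12.RunParams).K (S.cpl ⟨K, m, g₀⟩ (⟨K, m, g₀⟩ : B12.RunParams).K) (S.cpl ⟨K, m, g₀⟩) := by
    rw [show (⟨K, m, g₀⟩ : B12.RunParams).K = K from rfl, hend]
    exact h031
  exact ⟨(suffix_bounds_of_discrete031 hR.rg h031' hk).1, af_steps_density hD hC hR h031' hk⟩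

/-! ## §2 CONSEQUENCES on the as-printed carrier: what the lower half of (0.31) hands downstream -/

/-- **THE BARE COUPLING LAW AND THE ASYMPTOTIC-FREEDOM ENVELOPE, FROM THEOREM 2 AS PRINTED.**  `Definitions S` ((0.18): every run starts at its bare
coupling) and `Theorem2Statement S hL` give, for every m: ∃ γ₀ > 0 ∀ γ ∈ ]0, γ₀] ∃ g₁ > 0 ∀ g ∈ ]0, g₁] ∃ 0 < β ≤ β′ ∀ K ∃ g₀: the run (K, m, g₀)
lies in ]0, γ], ends at g_K = g, and
* `1∕(1∕g² + β′ ln L·K) ≤ g₀² ≤ 1∕(1∕g² + β ln L·K)` — the bare coupling is PINNED: with ε = L^{−K}, `K ln L = log ε⁻¹`, this is the two-sided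
  form of [Balaban1989LargeFieldI] p. 175 *"the bare coupling constant behaves asymptotically as (a + b log ε⁻¹)^{−1∕2}"* (a = 1∕g²);
* `g_k ≤ g` and `g_k² ≤ 1∕(1∕g² + β ln L·(K − k))` for every k ≤ K — all effective couplings sit below the renormalized one and under the
  asymptotic-freedom envelope;
* `Σ_{k<K} g_k⁶ ≤ g⁴∕(2β ln L)` — the summability that [Balaban1988Convergent] (2.46) consumes, uniformly in K.
A REDUCTION over the interface's named fields (`tunedRuns_of_theorem2Statement`, `h0_of_definitions`); nothing of [I] asserted. [cite: Balaban1987RG1, Thm 2 (0.31) p.259 with (0.18) p.255; Balaban1989LargeFieldI, p.175; Balaban1988Convergent, (2.46) p.263] -/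
theorem bareCoupling_law_of_theorem2Statement (hD : Definitions S) {hL : Odd S.L ∧ 1 < S.L} (h : Theorem2Statement S hL)
    (m : ℕ) :
    ∃ γ₀ : ℝ, 0 < γ₀ ∧ ∀ γ : ℝ, 0 < γ → γ ≤ γ₀ → ∃ g₁ : ℝ, 0 < g₁ ∧ ∀ g : ℝ, 0 < g → g ≤ g₁ →
      ∃ β β' : ℝ, 0 < β ∧ β ≤ β' ∧ ∀ K : ℕ, ∃ g₀ : ℝ,
        Step.InInterval γ K (S.cpl ⟨K, m, g₀⟩) ∧ S.cpl ⟨K, m, g₀⟩ K = g ∧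
          1 / (1 / g ^ 2 + β' * Real.log S.L * K) ≤ g₀ ^ 2 ∧ g₀ ^ 2 ≤ 1 / (1 / g ^ 2 + β * Real.log S.L * K) ∧
          (∀ k, k ≤ K → S.cpl ⟨K, m, g₀⟩ k ≤ g ∧
            (S.cpl ⟨K, m, g₀⟩ k) ^ 2 ≤ 1 / (1 / g ^ 2 + β * Real.log S.L * ((K : ℝ) - k))) ∧
          ∑ k ∈ Finset.range K, (S.cpl ⟨K, m, g₀⟩ k) ^ 6 ≤ g ^ 4 / (2 * (β * Real.log S.L)) := by
  have hlog : 0 < Real.log (S.L : ℝ) := Real.log_pos (by exact_mod_cast hL.2)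
  obtain ⟨γ₀, hγ₀, hγ⟩ := tunedRuns_of_theorem2Statement h m
  refine ⟨γ₀, hγ₀, fun γ hγpos hγle => ?_⟩
  obtain ⟨g₁, hg₁, hg⟩ := hγ γ hγpos hγle
  refine ⟨g₁, hg₁, fun g hgpos hgle => ?_⟩
  obtain ⟨β, β', hβ, hββ', hK⟩ := hg g hgpos hgle
  refine ⟨β, β', hβ, hββ', fun K => ?_⟩
  obtain ⟨g₀, hI, hend, h031⟩ := hK K
  have hb : 0 < β * Real.log S.L := mul_pos hβ hlog
  have hbb' : β * Real.log S.L ≤ β' * Real.log S.L := mul_le_mul_of_nonneg_right hββ' hlog.le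
  have hpos : ∀ k, k ≤ K → 0 < S.cpl ⟨K, m, g₀⟩ k := fun k hk => (hI k hk).1
  have h0 : S.cpl ⟨K, m, g₀⟩ 0 = g₀ := hD.d018 ⟨K, m, g₀⟩
  have hbare := bare_sq_twoSided_of_discrete031 h031 hb.le hbb' hgpos (hpos 0 (Nat.zero_le K))
  rw [h0] at hbare
  refine ⟨g₀, hI, hend, ?_, ?_, fun k hk => ⟨le_final_of_discrete031_lower h031 hb.le hgpos hk (hpos k hk), ?_⟩,
    sum_pow_six_le_of_discrete031_lower h031 hb hgpos hpos⟩
  · simpa only [mul_assoc] using hbare.1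
  · simpa only [mul_assoc] using hbare.2
  · simpa only [mul_assoc] using sq_le_of_discrete031_lower h031 hb.le hgpos hk (hpos k hk)

/-- `log ε⁻¹ = K·ln L` for ε = L^{−K} (p. 256: *"hence ε = L^{−K}"*). [cite: Balaban1987RG1, §0 p.256] -/
theorem log_eps_inv (L : ℕ) (K : ℕ) : Real.log ((((L : ℝ) ^ K)⁻¹)⁻¹) = K * Real.log L := by
  rw [inv_inv, Real.log_pow]

/-- **THE BARE COUPLING VANISHES IN THE CONTINUUM LIMIT AT THE UNIVERSAL RATE (β log ε⁻¹)^{−1∕2}, UNIFORMLY IN THE RENORMALIZED COUPLING.**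
From `Definitions S` and `Theorem2Statement S hL`: for every m, every γ ∈ ]0, γ₀], every g ∈ ]0, g₁] there is β > 0 such that at every
K ≥ 1 (ε = L^{−K}) some bare coupling g₀ = g₀(ε, g) with the run in ]0, γ] ending at g_K = g satisfies `g₀²·(β log ε⁻¹) ≤ 1` — a bound free
of g.  ([Balaban1989LargeFieldI] p. 175: *"For d = 4 the bare coupling constant behaves asymptotically as (a + b log ε⁻¹)^{−1∕2}, for ε → 0"*;
here read off Theorem 2 AS PRINTED, with b = Theorem 2's β.) [cite: Balaban1989LargeFieldI, p.175; Balaban1987RG1, Thm 2 (0.31) p.259] -/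
theorem bareCoupling_rate_of_theorem2Statement (hD : Definitions S) {hL : Odd S.L ∧ 1 < S.L} (h : Theorem2Statement S hL)
    (m : ℕ) :
    ∃ γ₀ : ℝ, 0 < γ₀ ∧ ∀ γ : ℝ, 0 < γ → γ ≤ γ₀ → ∃ g₁ : ℝ, 0 < g₁ ∧ ∀ g : ℝ, 0 < g → g ≤ g₁ →
      ∃ β : ℝ, 0 < β ∧ ∀ K : ℕ, 1 ≤ K → ∃ g₀ : ℝ,
        Step.InInterval γ K (S.cpl ⟨K, m, g₀⟩) ∧ S.cpl ⟨K, m, g₀⟩ K = g ∧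
          g₀ ^ 2 * (β * Real.log ((((S.L : ℝ) ^ K)⁻¹)⁻¹)) ≤ 1 := by
  have hlog : 0 < Real.log (S.L : ℝ) := Real.log_pos (by exact_mod_cast hL.2)
  obtain ⟨γ₀, hγ₀, hγ⟩ := bareCoupling_law_of_theorem2Statement hD h m
  refine ⟨γ₀, hγ₀, fun γ hγpos hγle => ?_⟩
  obtain ⟨g₁, hg₁, hg⟩ := hγ γ hγpos hγle
  refine ⟨g₁, hg₁, fun g hgpos hgle => ?_⟩
  obtain ⟨β, β', hβ, -, hK⟩ := hg g hgpos hgle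
  refine ⟨β, hβ, fun K hK1 => ?_⟩
  obtain ⟨g₀, hI, hend, -, hup, -, -⟩ := hK K
  refine ⟨g₀, hI, hend, ?_⟩
  rw [log_eps_inv]
  have hc : 0 < β * Real.log S.L * K := by
    have : (1 : ℝ) ≤ K := by exact_mod_cast hK1
    positivity
  have h1 : g₀ ^ 2 ≤ 1 / (β * Real.log S.L * K) :=
    hup.trans (one_div_le_one_div_of_le hc (by linarith [one_div_pos.mpr (pow_pos hgpos 2)]))
  have h2 : g₀ ^ 2 * (β * Real.log S.L * K) ≤ 1 := by
    have := mul_le_mul_of_nonneg_right h1 hc.le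
    rwa [one_div_mul_cancel hc.ne'] at this
  calc g₀ ^ 2 * (β * (K * Real.log S.L)) = g₀ ^ 2 * (β * Real.log S.L * K) := by ring
    _ ≤ 1 := h2

end

end Summit.QuantumFields.BalabanUV.Beta.EriceFlowEnclosureB12AsPrintedLower
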